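import Mathlib
import Summits.NavierStokesRegularity.NavierStokesRegularity.Theorems.ThreadingFluxHorizonTowerZonalAlgebra
import HarnessLib

/-!
# Crux `PoloidalLiouville` (stmt-NavierStokesRegularity-1222, wall W1), crux idea «horizon-threading-tower» (ns-idea-15):
# ALL-DEGREE horizon zonality, kernel part F5b — THE SLOT VANISHING THEOREM (memo §2: identity (2.1), closed form (2.2))

Support file (Theorems-side tooling; seat ns-wall-eng-5 g4, cell ns-wall-extremal, W1 adjunct; `--supports stmt-NavierStokesRegularity-1222
--as helper`).  Memo of record: pub/ns-wall-extremal/ARM-B/zonal-eng5/PROOF-HZSD-ALL-L.md (DATUM B-w5.8).  In the complex coordinates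
`(W, V, Z) = (w, w̄, z)` of `ThreadingFluxHorizonTowerZonalAlgebra.lean`, a polynomial of azimuthal weight `M` and degree `l = M + dd`
is `Σ_k a_k W^{M+k} V^k Z^{dd−2k}` (`exists_sx_of_mem_support`); if it is `Δ̃`-harmonic its coefficients obey the recursion (1.2)
(`slot_recursion`), so `a₀ = 0` forces the slot to vanish (`slot_eq_zero_of_coeff_zero`); its jets at the axis point `(1,0,1)` are explicit in
`a₀, a₁, a₂` (`jet_*`), whence the value there of the cubic form `D̃` (the transported `det(∇H, ∇|∇H|², x)`):
`D̃(A)(1,0,1) = M(−2dd² a₀³ + 8(dd−M) a₀²a₁ + 8(M−1) a₀a₁² − 16M a₀²a₂)` (`eval_detC_slot`, memo (2.1) at `(z,ρ²) = (1,0)`), which with the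
recursion is `−M·dd(dd+M)(dd+M+1)(dd+2M+1)/((M+1)²(M+2)) · a₀³` (memo (2.2), `Φ(l,M) < 0`).  MAIN THEOREM ★ `slot_eq_zero`: **a weight-`M`
(`1 ≤ M`), degree-`M + dd` (`dd ≥ 1`) polynomial with `Δ̃A = 0` and `D̃(A) = 0` is zero** — the kernel form of «det-zonality forces the top
azimuthal weight of a degree-`l` harmonic to be `0` or `l`» for one weight slot (memo Corollary D).  Pure polynomial algebra; no analysis, no NS
statement.  HONEST LABEL: a lemma toward the crux-idea obstruction `HorizonZonalitySingleDegree` (all `l`); that statement (until the assembly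
lands), `PoloidalLiouville` (1222), `UnthreadedRigidity` (27585) and NS regularity remain OPEN; W1/W2 movement 0.  [folklore]
-/

-- the summit and its single problem share the name (D-0017 nested layout)
set_option linter.dupNamespace false

noncomputable section

open MvPolynomial Finsupp

namespace Summit.NavierStokesRegularity.NavierStokesRegularity.Theorems.PoloidalLiouville.HorizonTower.Zonal

/-! ### The harmonic weight slot: support, recursion, jets, and the vanishing theorem -/

section Slot

variable {A : CPoly} {M dd : ℕ}

/-- The `k`-th exponent of the weight-`M`, degree-`M + dd` slot: `W^{M+k} V^k Z^{dd−2k}`. -/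
def sx (M dd k : ℕ) : Fin 3 →₀ ℕ := tri (M + k) k (dd - 2 * k)

/-- `W`-exponent of the slot exponent `sx M dd k` is `M + k`. [folklore] -/
@[simp] theorem sx_zero (M dd k : ℕ) : sx M dd k 0 = M + k := by simp [sx]
/-- `V`-exponent of the slot exponent is `k`. [folklore] -/
@[simp] theorem sx_one (M dd k : ℕ) : sx M dd k 1 = k := by simp [sx]
/-- `Z`-exponent of the slot exponent is `dd − 2k`. [folklore] -/
@[simp] theorem sx_two (M dd k : ℕ) : sx M dd k 2 = dd - 2 * k := by simp [sx]

/-- Support of a slot polynomial: every monomial is `W^{M+k} V^k Z^{dd−2k}` with `2k ≤ dd`. -/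
theorem exists_sx_of_mem_support (hW : IsWeightedHomogeneous wt A (M : ℤ)) (hA : A.IsHomogeneous (M + dd))
    {d : Fin 3 →₀ ℕ} (hd : d ∈ A.support) : ∃ k, 2 * k ≤ dd ∧ d = sx M dd k := by
  obtain ⟨h1, h2⟩ := exponent_of_mem_support hW hA hd
  refine ⟨d 1, by omega, ?_⟩
  rw [eq_tri d, sx, tri_eq_tri_iff, tri_apply_one]
  omega

/-- Coefficients beyond the slot vanish: `coeff (sx k) A = 0` when `2k > dd`. -/
theorem coeff_sx_eq_zero_of_lt (hA : A.IsHomogeneous (M + dd)) {k : ℕ} (hk : dd < 2 * k) : coeff (sx M dd k) A = 0 := by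
  refine hA.coeff_eq_zero ?_
  rw [degree_eq_sum, Fin.sum_univ_three, sx_zero, sx_one, sx_two]
  omega

/-- A slot polynomial all of whose slot coefficients vanish is zero. -/
theorem eq_zero_of_coeff_sx_eq_zero (hW : IsWeightedHomogeneous wt A (M : ℤ)) (hA : A.IsHomogeneous (M + dd))
    (h : ∀ k, 2 * k ≤ dd → coeff (sx M dd k) A = 0) : A = 0 := by
  classical
  by_contra hne
  obtain ⟨d, hd⟩ := exists_coeff_ne_zero hne
  obtain ⟨k, hk, rfl⟩ := exists_sx_of_mem_support hW hA (MvPolynomial.mem_support_iff.mpr hd)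
  exact hd (h k hk)

/-- **Harmonic recursion** (memo (1.2)): for `Δ̃A = 0`, `4(M+k+1)(k+1)·a_{k+1} + (dd−2k)(dd−2k−1)·a_k = 0` (`2k + 2 ≤ dd`). -/
theorem slot_recursion (hlap : lapC A = 0) {k : ℕ} (hk : 2 * k + 2 ≤ dd) :
    4 * (((M : ℂ) + k) + 1) * ((k : ℂ) + 1) * coeff (sx M dd (k + 1)) A
      + (((dd : ℂ) - 2 * k) - 1) * ((dd : ℂ) - 2 * k) * coeff (sx M dd k) A = 0 := by
  have h0 : coeff (tri (M + k) k (dd - 2 * k - 2)) (lapC A) = 0 := by rw [hlap, coeff_zero]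
  unfold lapC at h0
  rw [coeff_add, coeff_C_mul, coeff_pderiv_pderiv, coeff_pderiv_pderiv] at h0
  simp only [tri_add_single_zero, tri_add_single_one, tri_add_single_two, tri_apply_zero, tri_apply_one, tri_apply_two] at h0
  have ex1 : tri (M + k + 1) (k + 1) (dd - 2 * k - 2) = sx M dd (k + 1) := by
    rw [sx, tri_eq_tri_iff]; omega
  have ex2 : tri (M + k) k (dd - 2 * k - 2 + 1 + 1) = sx M dd k := by
    rw [sx, tri_eq_tri_iff]; omega
  have c3 : (((dd - 2 * k - 2 + 1 : ℕ) : ℂ) + 1) = (dd : ℂ) - 2 * k := by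
    have : dd - 2 * k - 2 + 1 = dd - 2 * k - 1 := by omega
    rw [this, Nat.cast_sub (by omega : 1 ≤ dd - 2 * k), Nat.cast_sub (by omega : 2 * k ≤ dd)]
    push_cast; ring
  have c4 : (((dd - 2 * k - 2 : ℕ) : ℂ) + 1) = (dd : ℂ) - 2 * k - 1 := by
    rw [Nat.sub_sub, Nat.cast_sub (by omega : 2 * k + 2 ≤ dd)]
    push_cast; ring
  rw [ex1, ex2, c3, c4] at h0
  push_cast at h0
  linear_combination h0

/-- If the leading slot coefficient `a₀` vanishes, the whole slot vanishes (recursion + degree cut-off). -/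
theorem slot_eq_zero_of_coeff_zero (hW : IsWeightedHomogeneous wt A (M : ℤ)) (hA : A.IsHomogeneous (M + dd))
    (hlap : lapC A = 0) (h0 : coeff (sx M dd 0) A = 0) : A = 0 := by
  have hall : ∀ k, coeff (sx M dd k) A = 0 := by
    intro k
    induction k with
    | zero => exact h0
    | succ k ih =>
      by_cases hk : 2 * k + 2 ≤ dd
      · have hrec := slot_recursion (M := M) hlap hk
        rw [ih, mul_zero, add_zero] at hrec
        have hne : (4 * (((M : ℂ) + k) + 1) * ((k : ℂ) + 1)) ≠ 0 := by
          have h1 : ((M : ℂ) + k) + 1 ≠ 0 := by exact_mod_cast (Nat.succ_ne_zero (M + k))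
          have h2 : (k : ℂ) + 1 ≠ 0 := by exact_mod_cast (Nat.succ_ne_zero k)
          simp [h1, h2]
        exact (mul_eq_zero.mp hrec).resolve_left hne
      · exact coeff_sx_eq_zero_of_lt hA (by omega)
  exact eq_zero_of_coeff_sx_eq_zero hW hA fun k _ => hall k

end Slot

/-! ### Jets of a slot polynomial at the axis point -/

section Jets

variable {A : CPoly} {M dd : ℕ}

/-- Jet `∂_W A (1,0,1) = M·a₀`. [folklore] -/
theorem jet_d0 (hW : IsWeightedHomogeneous wt A (M : ℤ)) (hA : A.IsHomogeneous (M + dd)) (hM : 1 ≤ M) :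
    eval axisPt (pderiv 0 A) = (M : ℂ) * coeff (sx M dd 0) A := by
  have hw : IsWeightedHomogeneous wt (pderiv 0 A) ((M - 1 : ℕ) : ℤ) := by
    convert isWeightedHomogeneous_pderiv_zero hW using 2; push_cast [Nat.cast_sub hM]; ring
  rw [eval_axisPt_nat hw hA.pderiv, coeff_pderiv, tri_add_single_zero, tri_apply_zero]
  have ex : tri (M - 1 + 1) 0 (M + dd - 1 - (M - 1)) = sx M dd 0 := by rw [sx, tri_eq_tri_iff]; omega
  rw [ex, Nat.cast_sub hM]; push_cast; ring

/-- Jet `∂_V A (1,0,1) = a₁`. [folklore] -/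
theorem jet_d1 (hW : IsWeightedHomogeneous wt A (M : ℤ)) (hA : A.IsHomogeneous (M + dd)) :
    eval axisPt (pderiv 1 A) = coeff (sx M dd 1) A := by
  have hw : IsWeightedHomogeneous wt (pderiv 1 A) ((M + 1 : ℕ) : ℤ) := by
    convert isWeightedHomogeneous_pderiv_one hW using 2; push_cast; ring
  rw [eval_axisPt_nat hw hA.pderiv, coeff_pderiv, tri_add_single_one, tri_apply_one]
  have ex : tri (M + 1) (0 + 1) (M + dd - 1 - (M + 1)) = sx M dd 1 := by rw [sx, tri_eq_tri_iff]; omega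
  rw [ex]; push_cast; ring

/-- Jet `∂_Z A (1,0,1) = dd·a₀`. [folklore] -/
theorem jet_d2 (hW : IsWeightedHomogeneous wt A (M : ℤ)) (hA : A.IsHomogeneous (M + dd)) (hdd : 1 ≤ dd) :
    eval axisPt (pderiv 2 A) = (dd : ℂ) * coeff (sx M dd 0) A := by
  rw [eval_axisPt_nat (isWeightedHomogeneous_pderiv_two hW) hA.pderiv, coeff_pderiv, tri_add_single_two, tri_apply_two]
  have ex : tri M 0 (M + dd - 1 - M + 1) = sx M dd 0 := by rw [sx, tri_eq_tri_iff]; omega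
  have hc : M + dd - 1 - M = dd - 1 := by omega
  rw [ex, hc, Nat.cast_sub hdd]; push_cast; ring

/-- Jet `∂_W² A (1,0,1) = M(M−1)·a₀`. [folklore] -/
theorem jet_d00 (hW : IsWeightedHomogeneous wt A (M : ℤ)) (hA : A.IsHomogeneous (M + dd)) (hM : 1 ≤ M) :
    eval axisPt (pderiv 0 (pderiv 0 A)) = (M : ℂ) * ((M : ℂ) - 1) * coeff (sx M dd 0) A := by
  rcases Nat.lt_or_ge M 2 with hM1 | hM2
  · have hM' : M = 1 := by omega
    subst hM'
    have hw : IsWeightedHomogeneous wt (pderiv 0 (pderiv 0 A)) (-1 : ℤ) := by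
      convert isWeightedHomogeneous_pderiv_zero (isWeightedHomogeneous_pderiv_zero hW) using 2; push_cast
    rw [eval_axisPt_neg hw hA.pderiv.pderiv (by norm_num)]
    push_cast; ring
  · have hw : IsWeightedHomogeneous wt (pderiv 0 (pderiv 0 A)) ((M - 2 : ℕ) : ℤ) := by
      convert isWeightedHomogeneous_pderiv_zero (isWeightedHomogeneous_pderiv_zero hW) using 2
      push_cast [Nat.cast_sub hM2]; ring
    rw [eval_axisPt_nat hw hA.pderiv.pderiv, coeff_pderiv_pderiv]
    simp only [tri_add_single_zero, tri_apply_zero]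
    have ex : tri (M - 2 + 1 + 1) 0 (M + dd - 1 - 1 - (M - 2)) = sx M dd 0 := by rw [sx, tri_eq_tri_iff]; omega
    have c1 : ((M - 2 + 1 : ℕ) : ℂ) + 1 = M := by
      have : M - 2 + 1 = M - 1 := by omega
      rw [this, Nat.cast_sub (by omega : 1 ≤ M)]; push_cast; ring
    have c2 : ((M - 2 : ℕ) : ℂ) + 1 = (M : ℂ) - 1 := by rw [Nat.cast_sub hM2]; push_cast; ring
    rw [ex, c1, c2]; ring

/-- Jet `∂_W∂_V A (1,0,1) = (M+1)·a₁`. [folklore] -/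
theorem jet_d01 (hW : IsWeightedHomogeneous wt A (M : ℤ)) (hA : A.IsHomogeneous (M + dd)) :
    eval axisPt (pderiv 0 (pderiv 1 A)) = ((M : ℂ) + 1) * coeff (sx M dd 1) A := by
  have hw : IsWeightedHomogeneous wt (pderiv 0 (pderiv 1 A)) ((M : ℕ) : ℤ) := by
    convert isWeightedHomogeneous_pderiv_zero (isWeightedHomogeneous_pderiv_one hW) using 2; ring
  rw [eval_axisPt_nat hw hA.pderiv.pderiv, coeff_pderiv_pderiv]
  simp only [tri_add_single_zero, tri_add_single_one, tri_apply_zero, tri_apply_one]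
  have ex : tri (M + 1) (0 + 1) (M + dd - 1 - 1 - M) = sx M dd 1 := by rw [sx, tri_eq_tri_iff]; omega
  rw [ex]; push_cast; ring

/-- Jet `∂_W∂_Z A (1,0,1) = M·dd·a₀`. [folklore] -/
theorem jet_d02 (hW : IsWeightedHomogeneous wt A (M : ℤ)) (hA : A.IsHomogeneous (M + dd)) (hM : 1 ≤ M) (hdd : 1 ≤ dd) :
    eval axisPt (pderiv 0 (pderiv 2 A)) = (M : ℂ) * dd * coeff (sx M dd 0) A := by
  have hw : IsWeightedHomogeneous wt (pderiv 0 (pderiv 2 A)) ((M - 1 : ℕ) : ℤ) := by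
    convert isWeightedHomogeneous_pderiv_zero (isWeightedHomogeneous_pderiv_two hW) using 2
    push_cast [Nat.cast_sub hM]; ring
  rw [eval_axisPt_nat hw hA.pderiv.pderiv, coeff_pderiv_pderiv]
  simp only [tri_add_single_zero, tri_add_single_two, tri_apply_zero, tri_apply_two]
  have ex : tri (M - 1 + 1) 0 (M + dd - 1 - 1 - (M - 1) + 1) = sx M dd 0 := by rw [sx, tri_eq_tri_iff]; omega
  have c1 : ((M + dd - 1 - 1 - (M - 1) : ℕ) : ℂ) + 1 = dd := by
    have : M + dd - 1 - 1 - (M - 1) = dd - 1 := by omega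
    rw [this, Nat.cast_sub hdd]; push_cast; ring
  have c2 : ((M - 1 : ℕ) : ℂ) + 1 = M := by rw [Nat.cast_sub hM]; push_cast; ring
  rw [ex, c1, c2]; ring

/-- Jet `∂_V² A (1,0,1) = 2·a₂`. [folklore] -/
theorem jet_d11 (hW : IsWeightedHomogeneous wt A (M : ℤ)) (hA : A.IsHomogeneous (M + dd)) :
    eval axisPt (pderiv 1 (pderiv 1 A)) = 2 * coeff (sx M dd 2) A := by
  have hw : IsWeightedHomogeneous wt (pderiv 1 (pderiv 1 A)) ((M + 2 : ℕ) : ℤ) := by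
    convert isWeightedHomogeneous_pderiv_one (isWeightedHomogeneous_pderiv_one hW) using 2; push_cast; ring
  rw [eval_axisPt_nat hw hA.pderiv.pderiv, coeff_pderiv_pderiv]
  simp only [tri_add_single_one, tri_apply_one]
  have ex : tri (M + 2) (0 + 1 + 1) (M + dd - 1 - 1 - (M + 2)) = sx M dd 2 := by rw [sx, tri_eq_tri_iff]; omega
  rw [ex]; push_cast; ring

/-- Jet `∂_V∂_Z A (1,0,1) = (dd−2)·a₁`. [folklore] -/
theorem jet_d12 (hW : IsWeightedHomogeneous wt A (M : ℤ)) (hA : A.IsHomogeneous (M + dd)) :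
    eval axisPt (pderiv 1 (pderiv 2 A)) = ((dd : ℂ) - 2) * coeff (sx M dd 1) A := by
  have hw : IsWeightedHomogeneous wt (pderiv 1 (pderiv 2 A)) ((M + 1 : ℕ) : ℤ) := by
    convert isWeightedHomogeneous_pderiv_one (isWeightedHomogeneous_pderiv_two hW) using 2; push_cast; ring
  rw [eval_axisPt_nat hw hA.pderiv.pderiv, coeff_pderiv_pderiv]
  simp only [tri_add_single_one, tri_add_single_two, tri_apply_one, tri_apply_two]
  rcases Nat.lt_or_ge dd 3 with h3 | h3
  · -- `dd ≤ 2`: the exponent on the left has degree `M + 3 > M + dd`, and the right side vanishes too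
    have hz : coeff (tri (M + 1) (0 + 1) (M + dd - 1 - 1 - (M + 1) + 1)) A = 0 := by
      refine hA.coeff_eq_zero ?_
      rw [degree_tri]; omega
    rw [hz]
    rcases Nat.lt_or_ge dd 2 with h2 | h2
    · rw [coeff_sx_eq_zero_of_lt hA (by omega)]; ring
    · have : dd = 2 := by omega
      subst this; push_cast; ring
  · have ex : tri (M + 1) (0 + 1) (M + dd - 1 - 1 - (M + 1) + 1) = sx M dd 1 := by rw [sx, tri_eq_tri_iff]; omega
    have c1 : ((M + dd - 1 - 1 - (M + 1) : ℕ) : ℂ) + 1 = (dd : ℂ) - 2 := by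
      have : M + dd - 1 - 1 - (M + 1) = dd - 3 := by omega
      rw [this, Nat.cast_sub h3]; push_cast; ring
    rw [ex, c1]; push_cast; ring

/-- Jet `∂_Z² A (1,0,1) = dd(dd−1)·a₀`. [folklore] -/
theorem jet_d22 (hW : IsWeightedHomogeneous wt A (M : ℤ)) (hA : A.IsHomogeneous (M + dd)) (hdd : 1 ≤ dd) :
    eval axisPt (pderiv 2 (pderiv 2 A)) = (dd : ℂ) * ((dd : ℂ) - 1) * coeff (sx M dd 0) A := by
  rw [eval_axisPt_nat (isWeightedHomogeneous_pderiv_two (isWeightedHomogeneous_pderiv_two hW)) hA.pderiv.pderiv,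
    coeff_pderiv_pderiv]
  simp only [tri_add_single_two, tri_apply_two]
  rcases Nat.lt_or_ge dd 2 with h2 | h2
  · have hd1 : dd = 1 := by omega
    subst hd1
    have hz : coeff (tri M 0 (M + 1 - 1 - 1 - M + 1 + 1)) A = 0 := by
      refine hA.coeff_eq_zero ?_
      rw [degree_tri]; omega
    rw [hz]; push_cast; ring
  · have ex : tri M 0 (M + dd - 1 - 1 - M + 1 + 1) = sx M dd 0 := by rw [sx, tri_eq_tri_iff]; omega
    have c1 : ((M + dd - 1 - 1 - M + 1 : ℕ) : ℂ) + 1 = dd := by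
      have : M + dd - 1 - 1 - M + 1 = dd - 1 := by omega
      rw [this, Nat.cast_sub hdd]; push_cast; ring
    have c2 : ((M + dd - 1 - 1 - M : ℕ) : ℂ) + 1 = (dd : ℂ) - 1 := by
      have : M + dd - 1 - 1 - M = dd - 2 := by omega
      rw [this, Nat.cast_sub h2]; push_cast; ring
    rw [ex, c1, c2]; ring

end Jets

/-! ### The slot vanishing theorem (memo §2: identity (2.1), closed form (2.2), Corollary D for one slot) -/

section Vanishing

variable {A : CPoly} {M dd : ℕ}

/-- **The top-weight identity at the axis point** (memo (2.1) evaluated at `(z, ρ²) = (1, 0)`): for a weight-`M`, degree-`M + dd` slot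
polynomial `A` with slot coefficients `a₀, a₁, a₂`,
`D̃(A)(1,0,1) = M · ( −2dd²·a₀³ + 8(dd − M)·a₀²a₁ + 8(M − 1)·a₀a₁² − 16M·a₀²a₂ )`. -/
theorem eval_detC_slot (hW : IsWeightedHomogeneous wt A (M : ℤ)) (hA : A.IsHomogeneous (M + dd)) (hM : 1 ≤ M) (hdd : 1 ≤ dd) :
    eval axisPt (detC A)
      = (M : ℂ) * (-2 * (dd : ℂ) ^ 2 * coeff (sx M dd 0) A ^ 3
          + 8 * ((dd : ℂ) - M) * coeff (sx M dd 0) A ^ 2 * coeff (sx M dd 1) A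
          + 8 * ((M : ℂ) - 1) * coeff (sx M dd 0) A * coeff (sx M dd 1) A ^ 2
          - 16 * (M : ℂ) * coeff (sx M dd 0) A ^ 2 * coeff (sx M dd 2) A) := by
  unfold detC tripleC dotC lam
  simp only [map_add, map_sub, map_mul, pderiv_mul, pderiv_C, eval_C, eval_X, axisPt_zero, axisPt_one, axisPt_two,
    pderiv_comm 1 0 A, pderiv_comm 2 0 A, pderiv_comm 2 1 A, zero_mul, zero_add,
    jet_d0 hW hA hM, jet_d1 hW hA, jet_d2 hW hA hdd, jet_d00 hW hA hM, jet_d01 hW hA, jet_d02 hW hA hM hdd, jet_d11 hW hA,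
    jet_d12 hW hA, jet_d22 hW hA hdd]
  ring

/-- **Slot vanishing** (memo Corollary D for a single weight slot): a weight-`M` (`1 ≤ M`), degree-`l = M + dd` (`dd ≥ 1`, i.e. `M < l`)
polynomial in the complex coordinates that is `Δ̃`-harmonic and annihilated by the cubic form `D̃` is ZERO.  Proof: the harmonic recursion
(1.2) ties `a₁, a₂` to `a₀`; the identity `eval_detC_slot` then reads `−M·dd·(dd+M)(dd+M+1)(dd+2M+1)·a₀³ /((M+1)²(M+2)) = 0` (memo
(2.2): `Φ(l,M) = −(l−M)l(l+1)(l+M+1)/((M+1)²(M+2))`), so `a₀ = 0`, and the recursion kills the whole slot. -/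
theorem slot_eq_zero (hW : IsWeightedHomogeneous wt A (M : ℤ)) (hA : A.IsHomogeneous (M + dd)) (hM : 1 ≤ M) (hdd : 1 ≤ dd)
    (hlap : lapC A = 0) (hdet : detC A = 0) : A = 0 := by
  have hD := eval_detC_slot hW hA hM hdd
  rw [hdet, map_zero] at hD
  set a0 := coeff (sx M dd 0) A with ha0
  set a1 := coeff (sx M dd 1) A with ha1
  set a2 := coeff (sx M dd 2) A with ha2
  -- the recursion relations for `k = 0, 1` in subtraction-free-of-ℕ form
  have R0 : 4 * ((M : ℂ) + 1) * a1 + ((dd : ℂ) - 1) * dd * a0 = 0 := by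
    rcases Nat.lt_or_ge dd 2 with h | h
    · have hd1 : dd = 1 := by omega
      have hz : a1 = 0 := by rw [ha1]; exact coeff_sx_eq_zero_of_lt hA (by omega)
      rw [hz, hd1]; push_cast; ring
    · have h0 := slot_recursion (M := M) (dd := dd) (A := A) hlap (k := 0) (by omega)
      simp only [Nat.cast_zero, add_zero, mul_zero, sub_zero, zero_add] at h0
      rw [← ha0, ← ha1] at h0
      linear_combination h0
  have R1 : 8 * ((M : ℂ) + 2) * a2 + ((dd : ℂ) - 3) * ((dd : ℂ) - 2) * a1 = 0 := by
    rcases Nat.lt_or_ge dd 4 with h | h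
    · have hz : a2 = 0 := by rw [ha2]; exact coeff_sx_eq_zero_of_lt hA (by omega)
      rcases Nat.lt_or_ge dd 2 with h' | h'
      · have hz1 : a1 = 0 := by rw [ha1]; exact coeff_sx_eq_zero_of_lt hA (by omega)
        rw [hz, hz1]; ring
      · rcases Nat.lt_or_ge dd 3 with h'' | h''
        · have : dd = 2 := by omega
          rw [hz, this]; push_cast; ring
        · have : dd = 3 := by omega
          rw [hz, this]; push_cast; ring
    · have h1 := slot_recursion (M := M) (dd := dd) (A := A) hlap (k := 1) (by omega)
      simp only [Nat.cast_one] at h1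
      rw [← ha1, ← ha2] at h1
      linear_combination h1
  have key : (M : ℂ) * dd * ((dd : ℂ) + M) * ((dd : ℂ) + M + 1) * ((dd : ℂ) + 2 * M + 1) * a0 ^ 3 = 0 := by
    linear_combination ((M : ℂ) + 2) * ((M : ℂ) + 1) ^ 2 * hD
      + (-4 * a0 * a1 * M - 2 * a0 * a1 * M ^ 2 + 4 * a0 * a1 * M ^ 3 + 2 * a0 * a1 * M ^ 4 + 3 * a0 ^ 2 * M * dd
          + a0 ^ 2 * M * dd ^ 2 - a0 ^ 2 * M ^ 2 + 4 * a0 ^ 2 * M ^ 2 * dd - 3 * a0 ^ 2 * M ^ 3 - 2 * a0 ^ 2 * M ^ 4) * R0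
      + (-2 * a0 ^ 2 * M ^ 2 * ((M : ℂ) + 1) ^ 2) * R1
  have hMne : (M : ℂ) ≠ 0 := by exact_mod_cast (by omega : M ≠ 0)
  have hdne : (dd : ℂ) ≠ 0 := by exact_mod_cast (by omega : dd ≠ 0)
  have h3 : ((dd : ℂ) + M) ≠ 0 := by exact_mod_cast (by omega : dd + M ≠ 0)
  have h4 : ((dd : ℂ) + M + 1) ≠ 0 := by exact_mod_cast (by omega : dd + M + 1 ≠ 0)
  have h5 : ((dd : ℂ) + 2 * M + 1) ≠ 0 := by exact_mod_cast (by omega : dd + 2 * M + 1 ≠ 0)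
  have ha : a0 ^ 3 = 0 := by
    have := key
    simp only [mul_eq_zero, hMne, hdne, h3, h4, h5, false_or] at this
    exact this
  exact slot_eq_zero_of_coeff_zero hW hA hlap (by rw [← ha0]; exact pow_eq_zero_iff (n := 3) (by norm_num) |>.mp ha)

end Vanishing

end Summit.NavierStokesRegularity.NavierStokesRegularity.Theorems.PoloidalLiouville.HorizonTower.Zonal

end
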